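import Summits.BirchSwinnertonDyer.BirchSwinnertonDyer.Theorems.EisensteinPrimesAnomalousTowerTorsionCore
import Summits.BirchSwinnertonDyer.BirchSwinnertonDyer.Theorems.SchneiderFreeControlAtoms
import Literature.NumberTheory.GaloisRepresentations.FrobeniusPlaces
import Literature.NumberTheory.GaloisRepresentations.PadicAlgebraDegreeOnePlace
import HarnessLib

/-!
# Route `EisensteinPrimes`, crux 2 `GoodLatticeBDPValue` (stmt-BirchSwinnertonDyer-19032), line `halves`, V20 road
# brick (f), part 5: **Fin_v AT THE GOOD ANOMALOUS PLACE** — `E(K_{∞,v̄})[p^∞]` is FINITE on every `ℤ_p`-extension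
# `K_∞/K` ramified at `v̄`, in particular on the anticyclotomic tower (KY Prop. 1.3.3 (iii); the tree's
# `SchneiderFreeControlAtoms.LocalTowerTorsionFiniteAt (E_K) p κ v̄`)

Cell `bsd-eis` (home `run/shared/lean/pub/bsd-eis/`), width seat `bsd-line-x1-p1-w2` gen 3 (`--supports -19032`,
closes nothing). Keller–Yin arXiv:2402.12781v2 Prop. 1.3.3 (iii) (TeX L948–957): at the anomalous place `w ∣ p`,
«`A[p^∞](K_{∞,w}) = H⁰(K_w, M_f)` is finite» — the input of KY Lemma 1.3.6 (`ker(res_{M_f})` finite, hence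
`λ(𝔛^S_Gr(f)) = λ(𝔛^S_nr(f))`), which the v20 road for `stub_imprimLambda` needs to pass from the crux's Castella-STRICT
`𝔛^{Sf}_f` to KY's `nr`-dual (STATUS l.3162, reading (R2)). In the tree this is the predicate Fin_v,
`LocalTowerTorsionFiniteAt (W.baseChange K) p κ v̄ := (E_K[p^∞]^{D_v̄ ⊓ ker κ}).Finite`, proved so far only where
`E(K_v̄)[p] = 0` (NOT the anomalous case), on additive cells and at split multiplicative primes. This file proves it at a
good ANOMALOUS prime, on exactly the binders of crux 2, by the Galois-module argument of part 4
(`finite_fixedPoints_geomPrimaryTorsion_of_frob`) transported along `E(ℚ̄) ≃ E_K(K̄)`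
(`exists_addEquiv_geomPoints_baseChange`) and conjugated to the prime `𝔓₀` of `\bar ℤ` cut out by the place:

* §1 plumbing at a split prime: `natCard_map_line_eq`, `inertiaDeg_eq_one_of_split`, `mem_decomp_of_isArithFrobAt`
  (an arithmetic Frobenius at `𝔓_{v̄} = adicCompletionPrime K v̄` lies in `D_v̄ = GreenbergSelmer.decomp v̄`),
  `isClosed_inertia'`.
* §2 **`localTowerTorsionFiniteAt_of_exists_inertia_apply_ne_one`** — `E/ℚ` globally minimal, `p` odd, `Anom W p`, no
  unramified rational `p`-line, `K` imaginary quadratic with `p = v v̄` split, `κ` ANY `ℤ_p`-extension of `K` with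
  `κ(I_v̄) ≠ 1`: `LocalTowerTorsionFiniteAt (W.baseChange K) p κ v̄`. With `N = ρ res(D_v̄ ⊓ ker κ) ρ⁻¹ ≤ Γ_ℚ`
  (`ρ • 𝔔 = 𝔓₀`, `𝔔` the contraction of `𝔓_{v̄}`): (N1) from part 3's mover + part 1's descent; (N2) `I_{𝔓₀} = ρ I_𝔔 ρ⁻¹ =
  ρ res(I_v̄) ρ⁻¹` normalises `N`; (N3) `σ_K^{pᵐ} τ_K ∈ ker κ` for an arithmetic Frobenius `σ_K ∈ D_v̄` at `𝔓_{v̄}` and some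
  `τ_K ∈ I_v̄` (part 4 §1, `κ(I_v̄)` closed and `≠ 1`), `res σ_K` is an arithmetic Frobenius at `𝔔` (`f(v̄|p) = 1`,
  `isArithFrobAt_absGaloisRestrict_of_inertiaDeg_eq_one`), conjugate by `ρ` (`IsArithFrobAt.conj`).
* §3 **`localTowerTorsionFiniteAt_of_isAnticyclotomic`** — the ANTICYCLOTOMIC tower is ramified at `v̄`
  (`exists_mem_inertia_apply_ne_one_of_isAnticyclotomic`, Brink), hence Fin_v there:
  **`E(K^{ac}_{∞,v̄})[p^∞]` is finite at a good anomalous `p`** — KY Prop. 1.3.3 (iii) in the kernel.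

HONEST FRAMING: helper theorems only (0 definitions, 0 named facts, 0 sorry); no summit statement, no BSD / IMC2 / KY
Thm 1.4.1 (iii) is proved; 0 cells / labels move. References: [KellerYin2024] §1.3 Prop. 1.3.3 (iii), Lemma 1.3.6
(arXiv:2402.12781v2 TeX L948–957, L1047–1060); [Brink2007] Cor. 1; [GreenbergLNM1716] §3 Lemma 3.3;
[JetchevSkinnerWan2017] §3.3 Prop. 3.3.4 Case 3(b); [NeukirchANT1999] Ch. I §9 (9.3)–(9.6).
-/

set_option autoImplicit false
-- the route's Theorems namespace repeats the summit name by design (D-0017 nested layout)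
set_option linter.dupNamespace false

noncomputable section

open scoped Classical Pointwise

namespace Summit.BirchSwinnertonDyer.BirchSwinnertonDyer.Theorems.AnomalousLocalTorsion

open NumberField IsDedekindDomain Field WeierstrassCurve Rat.HeightOneSpectrum
  Literature.NumberTheory.EllipticCurves Literature.NumberTheory.EllipticCurves.GreenbergSelmer
  Literature.NumberTheory.EllipticCurves.Rank1Residual Literature.NumberTheory.GaloisRepresentations
  Literature.NumberTheory.EllipticCurves.InertiaFixedPoint
  Summit.BirchSwinnertonDyer.BirchSwinnertonDyer.Theorems.SchneiderFreeControlAtoms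

variable (W : WeierstrassCurve ℚ) [W.IsElliptic] [W.IsGloballyMinimal] {p : ℕ} [hp : Fact p.Prime]
  {K : Type} [Field K] [NumberField K]

/-! ## §1. Plumbing at a split prime -/

omit [W.IsElliptic] [W.IsGloballyMinimal] hp in
/-- A `p`-line of `E[p](ℚ̄)` pushed along `P ↦ e (ρ • P)` into `E_K(K̄)` is a `Γ_K`-stable-able line of the same order inside
`E_K[p]`. [folklore] -/
theorem map_line_baseChange (e : geomPoints W ≃+ geomPoints (W.baseChange K)) (ρ : absoluteGaloisGroup ℚ)
    {Φ₀ : AddSubgroup (geomTorsion W (p : ℤ))} (hΦ₀ : Nat.card Φ₀ = p) :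
    Nat.card (Φ₀.map (e.toAddMonoidHom.comp ((DistribSMul.toAddMonoidHom (geomPoints W) ρ).comp
      (geomTorsion W (p : ℤ)).subtype))) = p ∧
    Φ₀.map (e.toAddMonoidHom.comp ((DistribSMul.toAddMonoidHom (geomPoints W) ρ).comp
      (geomTorsion W (p : ℤ)).subtype)) ≤ geomTorsion (W.baseChange K) (p : ℤ) := by
  set f := e.toAddMonoidHom.comp ((DistribSMul.toAddMonoidHom (geomPoints W) ρ).comp
    (geomTorsion W (p : ℤ)).subtype) with hf
  have hfinj : Function.Injective f := by
    intro a b hab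
    have h : e (ρ • (a : geomPoints W)) = e (ρ • (b : geomPoints W)) := hab
    exact Subtype.ext (smul_left_cancel ρ (e.injective h))
  refine ⟨by rw [Nat.card_congr (Φ₀.equivMapOfInjective f hfinj).toEquiv.symm, hΦ₀], ?_⟩
  rintro _ ⟨Q, -, rfl⟩
  refine (Submodule.mem_torsionBy_iff _ _).mpr ?_
  change (p : ℤ) • e (ρ • (Q : geomPoints W)) = 0
  rw [← map_zsmul, smul_comm, show (p : ℤ) • (Q : geomPoints W) = 0 from (Submodule.mem_torsionBy_iff _ _).mp Q.2,
    smul_zero, map_zero]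

omit [W.IsElliptic] [W.IsGloballyMinimal] in
/-- `f(v̄ ∣ p) = 1` for the two places above a prime split in an imaginary quadratic field. [folklore] -/
theorem inertiaDeg_eq_one_of_split (hK : IsImaginaryQuadratic K) {v vbar : HeightOneSpectrum (𝓞 K)}
    (hpv : ((p : ℕ) : 𝓞 K) ∈ v.asIdeal) (hpvbar : ((p : ℕ) : 𝓞 K) ∈ vbar.asIdeal) (hne : vbar ≠ v) :
    vbar.asIdeal.inertiaDeg (𝓞 ℚ) = 1 := by
  haveI : Algebra.IsQuadraticExtension ℚ K := ⟨hK.1⟩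
  exact (LocalField.ramificationIdx_eq_one_and_inertiaDeg_eq_one_of_ne p vbar v hne hpvbar hpv).1.2

omit [W.IsElliptic] [W.IsGloballyMinimal] hp in
/-- An arithmetic Frobenius at `𝔓_{v̄} = adicCompletionPrime K v̄` lies in `D_v̄ = GreenbergSelmer.decomp v̄`. [folklore] -/
theorem mem_decomp_of_isArithFrobAt {vbar : HeightOneSpectrum (𝓞 K)} {σ : absoluteGaloisGroup K}
    (hσ : IsArithFrobAt (𝓞 K) σ (adicCompletionPrime K vbar)) : σ ∈ GreenbergSelmer.decomp vbar := by
  have h : σ ∈ (adicCompletionPrime K vbar).decompositionSubgroup (absoluteGaloisGroup K) := hσ.mem_stabilizer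
  rw [decompositionSubgroup_adicCompletionPrime_eq_range] at h
  exact h

omit [W.IsElliptic] [W.IsGloballyMinimal] hp in
/-- `I_v̄ = GreenbergSelmer.inertia v̄` is closed. [cite: NeukirchANT1999, Ch. II §9 remark after (9.3)] -/
theorem isClosed_inertia' (vbar : HeightOneSpectrum (𝓞 K)) :
    IsClosed ((GreenbergSelmer.inertia vbar : Subgroup (absoluteGaloisGroup K)) : Set (absoluteGaloisGroup K)) := by
  have e : GreenbergSelmer.inertia vbar = (adicCompletionPrime K vbar).inertia (absoluteGaloisGroup K) :=
    (inertia_adicCompletionPrime_eq_map_absInertia K vbar).symm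
  rw [e]
  exact absIntegers.isClosed_inertia_holds (R := 𝓞 K) (K := K) (adicCompletionPrime K vbar)

/-! ## §2. Fin_v at the good anomalous place for every `ℤ_p`-extension ramified at `v̄` -/

/-- **Fin_v at a good ANOMALOUS prime.** `E = W/ℚ` globally minimal, `p` odd with `Anom W p` (reducible, good,
`a_p ≡ 1`) and no unramified rational `p`-line, `K` imaginary quadratic with `p = v v̄` split, `κ` ANY `ℤ_p`-extension of
`K` whose inertia group at `v̄` is not killed by `κ` (`K_∞/K` ramified at `v̄`). Then
`E(K_{∞,v̄})[p^∞] = E_K[p^∞]^{D_v̄ ⊓ ker κ}` is FINITE: `LocalTowerTorsionFiniteAt (W.baseChange K) p κ v̄`.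
Keller–Yin Prop. 1.3.3 (iii) («`H⁰(K_w, M_f)` is finite») by Galois modules: transport to `E(ℚ̄)` and to the prime `𝔓₀` of
the place, then part 4's `finite_fixedPoints_geomPrimaryTorsion_of_frob` with `N = ρ res(D_v̄ ⊓ ker κ) ρ⁻¹`.
[cite: KellerYin2024, §1.3 Prop. 1.3.3 (iii) (arXiv:2402.12781v2 TeX L948–957)] [cite: GreenbergLNM1716, §3 Lemma 3.3 (p. 87)]
[cite: JetchevSkinnerWan2017, §3.3 Prop. 3.3.4 Case 3(b)] -/
theorem localTowerTorsionFiniteAt_of_exists_inertia_apply_ne_one (hp2 : p ≠ 2) (hanom : Anom W p)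
    (hGL : ∀ Φ : AddSubgroup (geomTorsion W (p : ℤ)), IsRationalLine W p Φ → ¬ LineUnramifiedAt W p Φ)
    (hK : IsImaginaryQuadratic K) {v vbar : HeightOneSpectrum (𝓞 K)} (hpv : ((p : ℕ) : 𝓞 K) ∈ v.asIdeal)
    (hpvbar : ((p : ℕ) : 𝓞 K) ∈ vbar.asIdeal) (hne : vbar ≠ v) (κ : ZpExtension K p)
    (hram : ∃ τ ∈ GreenbergSelmer.inertia vbar, κ τ ≠ 1) :
    LocalTowerTorsionFiniteAt (W.baseChange K) p κ vbar := by
  have hpr : p.Prime := hp.out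
  -- good ordinary at `p`
  have hΔ : ¬ (p : ℤ) ∣ minimalDiscriminantInt W := W.not_dvd_minimalDiscriminantInt_of_hasGoodReductionAtPrime' p hanom.2.1
  have hord : ¬ (p : ℤ) ∣ W.frobeniusTrace p := by
    intro h
    have h1 : (p : ℤ) ∣ 1 := by
      have := dvd_sub h hanom.2.2
      rwa [sub_sub_cancel] at this
    exact hpr.one_lt.ne' (by exact_mod_cast Int.eq_one_of_dvd_one (Int.natCast_nonneg p) h1)
  -- the place of `ℚ` below `v̄`, the prime `𝔓₀` of the place, the contraction `𝔔` of `𝔓_{v̄}`, and `ρ • 𝔔 = 𝔓₀`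
  set u : HeightOneSpectrum (𝓞 ℚ) := vbar.under (𝓞 ℚ) with hudef
  have hu : (p : 𝓞 ℚ) ∈ u.asIdeal := natCast_mem_under_rat (K := K) hpvbar
  have hv : (primesEquiv u : ℕ) = p := primesEquiv_eq_of_natCast_mem hpr hu
  obtain ⟨𝔓₀, hmem, h𝔓₀⟩ := exists_ideal_placeOver p hv
  obtain ⟨hres, h𝔔⟩ := map_absGaloisRestrict_inertia_eq_of_split (p := p) hK hpv hpvbar hne
  set 𝔓K : Ideal (absIntegers (𝓞 K) K) := adicCompletionPrime K vbar with h𝔓K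
  set 𝔔 : Ideal (absIntegers (𝓞 ℚ) ℚ) := 𝔓K.comap (absIntegersMap ℚ K) with h𝔔def
  obtain ⟨ρ, hρ⟩ := HeightOneSpectrum.exists_smul_eq_of_mem_primesAbove_holds (K := ℚ) (v := u) h𝔔 h𝔓₀
  -- the rational line and the equivariant identification
  obtain ⟨Φ₀, hΦ₀⟩ := exists_isRationalLine_of_not_irr W p hanom.1
  have hramΦ : ¬ LineUnramifiedAt W p Φ₀ := hGL Φ₀ hΦ₀
  obtain ⟨e, he⟩ := W.exists_addEquiv_geomPoints_baseChange K
  have he' : ∀ (γ : absoluteGaloisGroup K) (Q : geomPoints (W.baseChange K)),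
      e.symm (γ • Q) = absGaloisRestrict ℚ K γ • e.symm Q := fun γ Q ↦ by
    apply e.injective; rw [he, AddEquiv.apply_symm_apply, AddEquiv.apply_symm_apply]
  set r : absoluteGaloisGroup K →* absoluteGaloisGroup ℚ := (absGaloisRestrict ℚ K).toMonoidHom with hrdef
  have hr : ∀ γ, r γ = absGaloisRestrict ℚ K γ := fun _ ↦ rfl
  -- the local tower group and its conjugate-restriction `N ≤ Γ_ℚ`
  set NK : Subgroup (absoluteGaloisGroup K) := GreenbergSelmer.decomp vbar ⊓ κ.kerSubgroup with hNK
  set N : Subgroup (absoluteGaloisGroup ℚ) := (NK.map r).map (MulAut.conj ρ).toMonoidHom with hNdef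
  have hmemN : ∀ x, x ∈ N ↔ ∃ g ∈ NK, x = ρ * r g * ρ⁻¹ := by
    intro x
    rw [hNdef, Subgroup.mem_map]
    constructor
    · rintro ⟨y, hy, rfl⟩
      obtain ⟨g, hg, rfl⟩ := Subgroup.mem_map.mp hy
      exact ⟨g, hg, rfl⟩
    · rintro ⟨g, hg, rfl⟩
      exact ⟨r g, Subgroup.mem_map.mpr ⟨g, hg, rfl⟩, rfl⟩
  have hNK_conj : ∀ {t : absoluteGaloisGroup K}, t ∈ GreenbergSelmer.decomp vbar → ∀ g ∈ NK, t⁻¹ * g * t ∈ NK := by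
    intro t ht g hg
    obtain ⟨hgD, hgk⟩ := Subgroup.mem_inf.mp hg
    refine Subgroup.mem_inf.mpr ⟨Subgroup.mul_mem _ (Subgroup.mul_mem _ (Subgroup.inv_mem _ ht) hgD) ht, ?_⟩
    rw [ZpExtension.mem_kerSubgroup] at hgk ⊢
    rw [map_mul, map_mul, map_inv, hgk, mul_one, inv_mul_cancel]
  -- (N1): `N` moves `Φ₀` — the pushed line `e(ρ⁻¹ • Φ₀)` is `Γ_K`-stable, moved by `I_v̄`, hence by `D_v̄ ⊓ ker κ`
  have hN1 : ∃ x ∈ N, ∃ P ∈ Φ₀, x • P ≠ P := by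
    set fK := e.toAddMonoidHom.comp ((DistribSMul.toAddMonoidHom (geomPoints W) ρ⁻¹).comp
      (geomTorsion W (p : ℤ)).subtype) with hfK
    obtain ⟨hcardK, hleK⟩ := map_line_baseChange W (K := K) e ρ⁻¹ hΦ₀.1
    have hfK_apply : ∀ Q : geomTorsion W (p : ℤ), fK Q = e (ρ⁻¹ • (Q : geomPoints W)) := fun _ ↦ rfl
    have hstabK : ∀ (γ : absoluteGaloisGroup K), ∀ P ∈ Φ₀.map fK, γ • P ∈ Φ₀.map fK := by
      rintro γ _ ⟨Q, hQ, rfl⟩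
      refine ⟨(ρ * absGaloisRestrict ℚ K γ * ρ⁻¹) • Q, hΦ₀.2 _ Q hQ, ?_⟩
      rw [hfK_apply, hfK_apply, AddSubgroup.torsionBy.coe_smul, ← he, smul_smul, smul_smul]
      congr 2; group
    obtain ⟨τ, hτ, P, hP, hτP⟩ :=
      exists_mem_inertia_smul_ne W hp2 hanom hGL hK hpv hpvbar hne hleK hcardK hstabK
    obtain ⟨g, hg, Q', hQ', hgQ'⟩ := exists_mem_inf_kerSubgroup_smul_ne κ (GreenbergSelmer.decomp vbar)
      (isClosed_decomp vbar) (continuous_smul_geomPoints (W.baseChange K)) _ hcardK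
      (GreenbergSelmer.inertia_le_decomp vbar hτ) (fun Q hQ ↦ hstabK τ Q hQ) ⟨P, hP, hτP⟩
    obtain ⟨Q, hQ, rfl⟩ := hQ'
    refine ⟨ρ * r g * ρ⁻¹, (hmemN _).mpr ⟨g, hg, rfl⟩, Q, hQ, fun h ↦ hgQ' ?_⟩
    rw [hfK_apply, ← he, ← hr]
    congr 1
    have h' := congrArg (fun z : geomTorsion W (p : ℤ) ↦ ρ⁻¹ • (z : geomPoints W)) h
    simp only [AddSubgroup.torsionBy.coe_smul, smul_smul] at h'
    rw [show ρ⁻¹ * (ρ * r g * ρ⁻¹) = r g * ρ⁻¹ by group, ← smul_smul] at h'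
    exact h'
  -- (N2): `I_{𝔓₀}` normalises `N`
  have hN2 : ∀ τ ∈ 𝔓₀.inertia (absoluteGaloisGroup ℚ),
      ∀ b ∈ FixedPoints.addSubgroup N (geomPrimaryTorsion W p), τ • b ∈ FixedPoints.addSubgroup N (geomPrimaryTorsion W p) := by
    intro τ hτ b hb
    -- `ρ⁻¹ τ ρ ∈ I_𝔔 = res(I_v̄)`
    rw [← hρ] at hτ
    have hτ' : ρ⁻¹ * τ * ρ ∈ (GreenbergSelmer.inertia vbar).map r := by
      rw [hres]; exact (HeightOneSpectrum.mem_inertia_smul_absIntegers_iff ρ τ 𝔔).mp hτ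
    obtain ⟨τK, hτK, hτKr⟩ := Subgroup.mem_map.mp hτ'
    rw [FixedPoints.mem_addSubgroup] at hb ⊢
    rintro ⟨x, hx⟩
    obtain ⟨g, hg, rfl⟩ := (hmemN x).mp hx
    rw [Subgroup.mk_smul]
    have hconj : τ⁻¹ * (ρ * r g * ρ⁻¹) * τ ∈ N := by
      refine (hmemN _).mpr ⟨τK⁻¹ * g * τK, hNK_conj (GreenbergSelmer.inertia_le_decomp vbar hτK) g hg, ?_⟩
      rw [map_mul, map_mul, map_inv, hτKr]; group
    have h := hb ⟨_, hconj⟩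
    rw [Subgroup.mk_smul] at h
    calc (ρ * r g * ρ⁻¹) • τ • b = τ • ((τ⁻¹ * (ρ * r g * ρ⁻¹) * τ) • b) := by
          rw [← mul_smul, ← mul_smul]; congr 1; group
      _ = τ • b := by rw [h]
  -- (N3): a Frobenius power lands in `N` up to inertia
  have hN3 : ∃ σ : absoluteGaloisGroup ℚ, IsArithFrobAt (𝓞 ℚ) σ 𝔓₀ ∧ ∃ n : ℕ, n ≠ 0 ∧
      ∃ τ ∈ 𝔓₀.inertia (absoluteGaloisGroup ℚ), σ ^ n * τ ∈ N := by
    obtain ⟨σK, hσK⟩ := HeightOneSpectrum.exists_isArithFrobAt_of_mem_primesAbove_holds (K := K) (v := vbar)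
      (adicCompletionPrime_mem_primesAbove K vbar)
    have hσKD : σK ∈ GreenbergSelmer.decomp vbar := mem_decomp_of_isArithFrobAt hσK
    obtain ⟨τ₀, hτ₀, hτ₀ne⟩ := hram
    obtain ⟨m, τK, hτK, hker⟩ := exists_pow_mul_mem_kerSubgroup κ (GreenbergSelmer.inertia vbar)
      (isClosed_inertia' vbar) hτ₀ hτ₀ne σK
    -- `res σK` is an arithmetic Frobenius at `𝔔`, `ρ res(σK) ρ⁻¹` one at `𝔓₀`
    have hwu : vbar.asIdeal.under (𝓞 ℚ) = u.asIdeal := (HeightOneSpectrum.under_asIdeal (𝓞 ℚ) vbar).symm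
    have hFrob𝔔 : IsArithFrobAt (𝓞 ℚ) (r σK) 𝔔 :=
      isArithFrobAt_absGaloisRestrict_of_inertiaDeg_eq_one hwu (adicCompletionPrime_mem_primesAbove K vbar) hσK
        (inertiaDeg_eq_one_of_split (p := p) hK hpv hpvbar hne)
    have hFrob : IsArithFrobAt (𝓞 ℚ) (ρ * r σK * ρ⁻¹) 𝔓₀ := by
      have h := hFrob𝔔.conj ρ
      rwa [hρ] at h
    refine ⟨ρ * r σK * ρ⁻¹, hFrob, p ^ m, pow_ne_zero _ hpr.ne_zero, ρ * r τK * ρ⁻¹, ?_, ?_⟩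
    · -- `ρ res(τK) ρ⁻¹ ∈ I_{ρ • 𝔔} = I_{𝔓₀}`
      rw [← hρ]
      refine (HeightOneSpectrum.mem_inertia_smul_absIntegers_iff ρ _ 𝔔).mpr ?_
      rw [show ρ⁻¹ * (ρ * r τK * ρ⁻¹) * ρ = r τK by group, ← hres]
      exact Subgroup.mem_map.mpr ⟨τK, hτK, rfl⟩
    · refine (hmemN _).mpr ⟨σK ^ p ^ m * τK, Subgroup.mem_inf.mpr ⟨Subgroup.mul_mem _
        (Subgroup.pow_mem _ hσKD _) (GreenbergSelmer.inertia_le_decomp vbar hτK), hker⟩, ?_⟩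
      have hcp : (ρ * r σK * ρ⁻¹) ^ p ^ m = ρ * (r σK) ^ p ^ m * ρ⁻¹ := by
        rw [← MulAut.conj_apply, ← map_pow, MulAut.conj_apply]
      rw [map_mul, map_pow, hcp]
      group
  -- the `ℚ`-side fixed part is finite
  have hfinQ := finite_fixedPoints_geomPrimaryTorsion_of_frob hΔ hord hmem hv hu h𝔓₀ hΦ₀ hramΦ N hN1 hN2 hN3
  haveI : Finite (FixedPoints.addSubgroup N (geomPrimaryTorsion W p)) := hfinQ.to_subtype
  -- transport `E_K[p^∞]^{D_v̄ ⊓ ker κ} ↪ E[p^∞]^N`, `b ↦ ρ • e⁻¹ b`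
  unfold LocalTowerTorsionFiniteAt
  set BK := FixedPoints.addSubgroup ↥(GreenbergSelmer.decomp vbar ⊓ κ.kerSubgroup)
    ((W.baseChange K).geomPrimaryTorsion p) with hBK
  have hι_mem : ∀ b : BK, ρ • e.symm ((b : (W.baseChange K).geomPrimaryTorsion p) : geomPoints (W.baseChange K)) ∈
      geomPrimaryTorsion W p := fun b ↦ by
    obtain ⟨k, hk⟩ := ((b : (W.baseChange K).geomPrimaryTorsion p)).2
    refine ⟨k, ?_⟩
    rw [smul_comm, ← map_nsmul, hk, map_zero, smul_zero]
  have hι_fix : ∀ b : BK, ∀ x ∈ N, x • (⟨_, hι_mem b⟩ : geomPrimaryTorsion W p) = ⟨_, hι_mem b⟩ := by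
    intro b x hx
    obtain ⟨g, hg, rfl⟩ := (hmemN x).mp hx
    apply Subtype.ext
    rw [primaryComponent.coe_smul]
    change (ρ * r g * ρ⁻¹) • ρ • e.symm _ = ρ • e.symm _
    have hgb : g • (b : (W.baseChange K).geomPrimaryTorsion p) = b := by
      have h := (FixedPoints.mem_addSubgroup _ _ _).mp b.2 ⟨g, hg⟩
      rwa [Subgroup.mk_smul] at h
    have hgb' : g • (((b : (W.baseChange K).geomPrimaryTorsion p)) : geomPoints (W.baseChange K)) =
        ((b : (W.baseChange K).geomPrimaryTorsion p) : geomPoints (W.baseChange K)) := by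
      rw [← primaryComponent.coe_smul, hgb]
    rw [← mul_smul, show ρ * r g * ρ⁻¹ * ρ = ρ * r g by group, mul_smul, hr, ← he', hgb']
  let ι : BK → FixedPoints.addSubgroup N (geomPrimaryTorsion W p) := fun b ↦
    ⟨⟨_, hι_mem b⟩, (FixedPoints.mem_addSubgroup _ _ _).mpr fun x ↦ by
      rw [Subgroup.mk_smul]; exact hι_fix b x.1 x.2⟩
  have hι : Function.Injective ι := by
    intro b₁ b₂ h
    have h' := congrArg (fun z : FixedPoints.addSubgroup N (geomPrimaryTorsion W p) ↦
      ((z : geomPrimaryTorsion W p) : geomPoints W)) h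
    have h'' : e.symm ((b₁ : (W.baseChange K).geomPrimaryTorsion p) : geomPoints (W.baseChange K)) =
        e.symm ((b₂ : (W.baseChange K).geomPrimaryTorsion p) : geomPoints (W.baseChange K)) := smul_left_cancel ρ h'
    exact Subtype.ext (Subtype.ext (e.symm.injective h''))
  haveI : Finite BK := Finite.of_injective ι hι
  exact Set.toFinite _

/-! ## §3. The anticyclotomic tower -/

/-- **`E(K^{ac}_{∞,v̄})[p^∞]` is FINITE at a good anomalous prime** (Keller–Yin Prop. 1.3.3 (iii) on the anticyclotomic
tower): `E/ℚ` globally minimal, `p` odd, `Anom W p`, no unramified rational `p`-line, `K` imaginary quadratic with `p = v v̄`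
split, `κ` ANTICYCLOTOMIC — then `LocalTowerTorsionFiniteAt (W.baseChange K) p κ v̄`. The anticyclotomic tower is ramified
at `v̄` (`exists_mem_inertia_apply_ne_one_of_isAnticyclotomic`, Brink), so §2 applies. The input of KY Lemma 1.3.6
(`λ(𝔛^{Sf}_Gr(f)) = λ(𝔛^{Sf}_nr(f))`) on the v20 road for `stub_imprimLambda`.
[cite: KellerYin2024, §1.3 Prop. 1.3.3 (iii) and Lemma 1.3.6 (arXiv:2402.12781v2 TeX L948–957, L1047–1060)]
[cite: Brink2007, Cor. 1 (p. 2136)] -/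
theorem localTowerTorsionFiniteAt_of_isAnticyclotomic (hp2 : p ≠ 2) (hanom : Anom W p)
    (hGL : ∀ Φ : AddSubgroup (geomTorsion W (p : ℤ)), IsRationalLine W p Φ → ¬ LineUnramifiedAt W p Φ)
    (hK : IsImaginaryQuadratic K) {v vbar : HeightOneSpectrum (𝓞 K)} (hpv : ((p : ℕ) : 𝓞 K) ∈ v.asIdeal)
    (hpvbar : ((p : ℕ) : 𝓞 K) ∈ vbar.asIdeal) (hne : vbar ≠ v) (κ : ZpExtension K p) (hκ : κ.IsAnticyclotomic) :
    LocalTowerTorsionFiniteAt (W.baseChange K) p κ vbar := by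
  obtain ⟨τ, hτ, hτne⟩ := ZpExtension.exists_mem_inertia_apply_ne_one_of_isAnticyclotomic hK hp2 κ hκ hpvbar
    (adicCompletionPrime_mem_primesAbove K vbar)
  refine localTowerTorsionFiniteAt_of_exists_inertia_apply_ne_one W hp2 hanom hGL hK hpv hpvbar hne κ ⟨τ, ?_, hτne⟩
  have e : GreenbergSelmer.inertia vbar = (adicCompletionPrime K vbar).inertia (absoluteGaloisGroup K) :=
    (inertia_adicCompletionPrime_eq_map_absInertia K vbar).symm
  rw [e]
  exact hτ

end Summit.BirchSwinnertonDyer.BirchSwinnertonDyer.Theorems.AnomalousLocalTorsion
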